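import Summits.CriticalPhenomena.PercolationContinuityZ3.Theorems.PercNearOneGluingNoHeavyQuantFarBlockReach
import Summits.CriticalPhenomena.PercolationContinuityZ3.Theorems.PercNearOneGluingNoHeavyQuantFarBundleLaw
import HarnessLib

/-!
# QUANT lane R8, front "FAR beyond trees", layer one — PENDANT BLOCKS II: the law decomposition `P(N ≥ 2) = A + B·h + C·t` for an
# arbitrary pendant vertex set

builds on p205010 (kernel theorem, internal audit signed; external expert review pending)

Support file (`--supports stmt-CriticalPhenomena-4575`), seat `prim-quant-p1` (gen 19); memo
`run/shared/lean/prim/quant/prim-quant-p1-g19/FOR-LEAD-CACTI.md` §1 (kernel plan §5, file K2).  Generalises `…QuantFarBundleLaw`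
(pockets) to arbitrary pendant blocks.  Standard axioms; no sorries; no definitions.

For a weight function `v : Sym2 (Fin n) → [0,1]` that vanishes on every pair between the block `Z` and `(Z ∪ {c})ᶜ`
(`o, c ∉ Z`), the configuration is almost surely `Block.Good`, so by `Block.card_filter_eq` the relay count of the observer is
`N = N_rest + J · X` with `N_rest`, `J = 𝟙[o ↔ c off Z]` determined by the pairs AVOIDING `Z` and the block count
`X = #{a ∈ A ∩ Z : c ↔ a on Z}` determined by the pairs MEETING `Z`; independence of disjoint coordinate sets gives

* `Block.real_two_le_card_eq` — **(D)**: `P_v(N ≥ 2) = P_v(N_rest ≥ 2) + P_v(N_rest = 1, J)·P_v(X ≥ 1) + P_v(N_rest = 0, J)·P_v(X ≥ 2)`;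
* `Block.real_openConn_in_eq` — marginal of a block vertex: `P_v(o ↔ a) = P_v(J)·P_v(c ↔ a on Z)`;  `Block.real_openConn_off_eq` — for
  `b ∉ Z`, `P_v(o ↔ b) = P_v(o ↔ b off Z)`;
* `Block.real_onZ_event_eq_of_agree` — the block quantities (any event read off `onZ`) agree for two weight functions that agree on the
  pairs meeting `Z`; the coefficients agree for weights agreeing off `Z` (`Bundle.real_offZ_event_eq_of_agree`);
* `Block.real_inter_J_le` — `P(N_rest ≥ 2) + P(N_rest = 1, J) + P(N_rest = 0, J) ≥ P(J)`.
[cite: Grimmett1999, §1.3 p. 10; §2.2] (product measure; events determined by finitely many coordinates); bookkeeping [this work].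
-/

noncomputable section

namespace Summit.CriticalPhenomena.PercolationContinuityZ3.Theorems

namespace Quant

namespace Block

open Finset MeasureTheory Set
open Literature.Probability.LatticeModels
open Literature.Probability.Percolation
open Bundle (offZ avoid offZ_eq_inter determinedBy_offZ)
open scoped Classical

variable {n : ℕ}

/-! ## Pairs meeting the block; determinacy -/

/-- `onZ Z ω` is `ω` restricted to the pairs meeting `Z` (the complement of `Bundle.avoid Z`). [this work] -/
theorem onZ_eq_inter (Z : Finset (Fin n)) (ω : BondConfig (Fin n)) : onZ Z ω = ω ∩ (↑(avoid Z) : Set (Sym2 (Fin n)))ᶜ := by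
  ext e; simp [onZ, avoid]

/-- Any event read off `onZ Z` is determined by the pairs meeting `Z`. [this work] -/
theorem determinedBy_onZ (Z : Finset (Fin n)) (P : BondConfig (Fin n) → Prop) :
    DeterminedBy {ω : BondConfig (Fin n) | P (onZ Z ω)} (↑(avoid Z) : Set (Sym2 (Fin n)))ᶜ := by
  rw [determinedBy_iff]
  intro ω ω' h
  simp only [mem_setOf_eq, onZ_eq_inter, h]

/-- **Block quantities do not see the weights off the block**: two weight functions agreeing on the pairs meeting `Z` give the same
probability to every event read off `onZ Z`. [this work] -/
theorem real_onZ_event_eq_of_agree (v v' : Sym2 (Fin n) → unitInterval) (Z : Finset (Fin n))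
    (hvv' : ∀ e, e ∉ avoid Z → v e = v' e) (P : BondConfig (Fin n) → Prop) :
    (prodBernoulli v).real {ω | P (onZ Z ω)} = (prodBernoulli v').real {ω | P (onZ Z ω)} :=
  prodBernoulli_real_eq_of_determinedBy v v' (fun e he => hvv' e (by rw [Set.mem_compl_iff, Finset.mem_coe] at he; exact he))
    (determinedBy_onZ Z P) (Set.toFinite _).measurableSet

/-! ## Almost-sure goodness -/

section Law

variable {o c : Fin n} {Z : Finset (Fin n)}

/-- If `v` vanishes on every pair between `Z` and `(Z ∪ {c})ᶜ`, the configuration is almost surely good: events agreeing on good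
configurations have the same probability. [this work] -/
theorem real_congr_of_good (v : Sym2 (Fin n) → unitInterval)
    (hv : ∀ x y : Fin n, x ≠ y → x ∈ Z → y ∉ Z → y ≠ c → (v s(x, y) : ℝ) = 0)
    (S T : Set (BondConfig (Fin n))) (hST : ∀ ω, Good c Z ω → (ω ∈ S ↔ ω ∈ T)) :
    (prodBernoulli v).real S = (prodBernoulli v).real T := by
  set μ := prodBernoulli v with hμ
  set Bd : Finset (Sym2 (Fin n)) := Finset.univ.filter fun e =>
    ∃ x y : Fin n, x ≠ y ∧ e = s(x, y) ∧ x ∈ Z ∧ y ∉ Z ∧ y ≠ c with hBd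
  set Nbad : Set (BondConfig (Fin n)) := {ω | ∃ e ∈ Bd, e ∈ ω} with hN
  have hmeas : ∀ U : Set (BondConfig (Fin n)), MeasurableSet U := fun U => (Set.toFinite U).measurableSet
  have hN0 : μ.real Nbad = 0 := by
    have h0 : μ Nbad = 0 := by
      apply prodBernoulli_setOf_exists_mem_eq_zero
      intro e he
      obtain ⟨x, y, hxy, rfl, hx, hy, hyc⟩ := (Finset.mem_filter.1 he).2
      exact hv x y hxy hx hy hyc
    simp [measureReal_def, h0]
  have hgood : ∀ ω : BondConfig (Fin n), ω ∉ Nbad → Good c Z ω := by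
    intro ω hω x y hxy he hx hy
    by_contra hyc
    exact hω ⟨s(x, y), Finset.mem_filter.2 ⟨Finset.mem_univ _, x, y, hxy, rfl, hx, hy, hyc⟩, he⟩
  have hsplit : ∀ U : Set (BondConfig (Fin n)), μ.real U = μ.real (U \ Nbad) := by
    intro U
    have h := measureReal_inter_add_sdiff (μ := μ) (s := U) (hmeas Nbad)
    have h0 : μ.real (U ∩ Nbad) = 0 :=
      le_antisymm ((measureReal_mono Set.inter_subset_right).trans hN0.le) measureReal_nonneg
    linarith
  have hdiff : S \ Nbad = T \ Nbad := by
    ext ω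
    simp only [Set.mem_sdiff]
    constructor
    · rintro ⟨hS, hω⟩; exact ⟨(hST ω (hgood ω hω)).1 hS, hω⟩
    · rintro ⟨hT, hω⟩; exact ⟨(hST ω (hgood ω hω)).2 hT, hω⟩
  rw [hsplit S, hsplit T, hdiff]

/-! ## The decomposition (D) -/

/-- **(D)** `P_v(N ≥ 2) = P_v(N_rest ≥ 2) + P_v(N_rest = 1, J)·P_v(X ≥ 1) + P_v(N_rest = 0, J)·P_v(X ≥ 2)` for every weight function
vanishing between the block and `(Z ∪ {c})ᶜ` (`o, c ∉ Z`); `N_rest`, `J` are read off `offZ Z`, `X = #{a ∈ A ∩ Z : c ↔ a on Z}` off `onZ Z`.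
[this work] -/
theorem real_two_le_card_eq (v : Sym2 (Fin n) → unitInterval) (ho : o ∉ Z) (hc : c ∉ Z)
    (hv : ∀ x y : Fin n, x ≠ y → x ∈ Z → y ∉ Z → y ≠ c → (v s(x, y) : ℝ) = 0) (A : Finset (Fin n)) :
    (prodBernoulli v).real {ω : BondConfig (Fin n) | 2 ≤ (A.filter fun a => ω ∈ openConn o a).card} =
      (prodBernoulli v).real {ω | 2 ≤ ((A \ Z).filter fun a => offZ Z ω ∈ openConn o a).card} +
      (prodBernoulli v).real {ω | ((A \ Z).filter fun a => offZ Z ω ∈ openConn o a).card = 1 ∧ offZ Z ω ∈ openConn o c} *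
        (prodBernoulli v).real {ω | 1 ≤ ((A ∩ Z).filter fun a => onZ Z ω ∈ openConn c a).card} +
      (prodBernoulli v).real {ω | ((A \ Z).filter fun a => offZ Z ω ∈ openConn o a).card = 0 ∧ offZ Z ω ∈ openConn o c} *
        (prodBernoulli v).real {ω | 2 ≤ ((A ∩ Z).filter fun a => onZ Z ω ∈ openConn c a).card} := by
  set μ := prodBernoulli v with hμ
  have hmeas : ∀ U : Set (BondConfig (Fin n)), MeasurableSet U := fun U => (Set.toFinite U).measurableSet
  set S := {ω : BondConfig (Fin n) | 2 ≤ (A.filter fun a => ω ∈ openConn o a).card} with hS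
  set S2 := {ω : BondConfig (Fin n) | 2 ≤ ((A \ Z).filter fun a => offZ Z ω ∈ openConn o a).card} with hS2
  set S1 := {ω : BondConfig (Fin n) | ((A \ Z).filter fun a => offZ Z ω ∈ openConn o a).card = 1 ∧
    offZ Z ω ∈ openConn o c} with hS1
  set S0 := {ω : BondConfig (Fin n) | ((A \ Z).filter fun a => offZ Z ω ∈ openConn o a).card = 0 ∧
    offZ Z ω ∈ openConn o c} with hS0
  set X1 := {ω : BondConfig (Fin n) | 1 ≤ ((A ∩ Z).filter fun a => onZ Z ω ∈ openConn c a).card} with hX1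
  set X2 := {ω : BondConfig (Fin n) | 2 ≤ ((A ∩ Z).filter fun a => onZ Z ω ∈ openConn c a).card} with hX2
  set T := S2 ∪ (S1 ∩ X1 ∪ S0 ∩ X2) with hT
  -- `S = T` on good configurations
  have hST : μ.real S = μ.real T := by
    refine real_congr_of_good (c := c) (Z := Z) v hv S T fun ω hω => ?_
    have hcard := card_filter_eq hω ho hc A
    simp only [hS, hT, hS2, hS1, hS0, hX1, hX2, mem_setOf_eq, Set.mem_union, Set.mem_inter_iff]
    rw [hcard]
    by_cases hj : offZ Z ω ∈ openConn o c
    · rw [if_pos hj]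
      simp only [hj, and_true]
      omega
    · rw [if_neg hj]
      simp only [hj, and_false, false_and, or_false, add_zero]
  have hd1 : Disjoint (S1 ∩ X1) (S0 ∩ X2) := by
    rw [Set.disjoint_left]
    rintro ω ⟨⟨h1, -⟩, -⟩ ⟨⟨h0, -⟩, -⟩
    omega
  have hd2 : Disjoint S2 (S1 ∩ X1 ∪ S0 ∩ X2) := by
    rw [Set.disjoint_left]
    rintro ω h2 (⟨⟨h1, -⟩, -⟩ | ⟨⟨h0, -⟩, -⟩)
    · simp only [hS2, mem_setOf_eq] at h2; omega
    · simp only [hS2, mem_setOf_eq] at h2; omega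
  have hTsum : μ.real T = μ.real S2 + μ.real (S1 ∩ X1) + μ.real (S0 ∩ X2) := by
    rw [hT, measureReal_union hd2 (hmeas _), measureReal_union hd1 (hmeas _), add_assoc]
  have hdetS1 : DeterminedBy S1 (↑(avoid Z) : Set (Sym2 (Fin n))) :=
    determinedBy_offZ Z fun η => ((A \ Z).filter fun a => η ∈ openConn o a).card = 1 ∧ η ∈ openConn o c
  have hdetS0 : DeterminedBy S0 (↑(avoid Z) : Set (Sym2 (Fin n))) :=
    determinedBy_offZ Z fun η => ((A \ Z).filter fun a => η ∈ openConn o a).card = 0 ∧ η ∈ openConn o c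
  have hdetX1 : DeterminedBy X1 (↑(avoid Z) : Set (Sym2 (Fin n)))ᶜ :=
    determinedBy_onZ Z fun η => 1 ≤ ((A ∩ Z).filter fun a => η ∈ openConn c a).card
  have hdetX2 : DeterminedBy X2 (↑(avoid Z) : Set (Sym2 (Fin n)))ᶜ :=
    determinedBy_onZ Z fun η => 2 ≤ ((A ∩ Z).filter fun a => η ∈ openConn c a).card
  have hi1 : μ.real (S1 ∩ X1) = μ.real S1 * μ.real X1 :=
    prodBernoulli_real_inter_of_determinedBy v (avoid Z) hdetS1 hdetX1 (hmeas _) (hmeas _)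
  have hi0 : μ.real (S0 ∩ X2) = μ.real S0 * μ.real X2 :=
    prodBernoulli_real_inter_of_determinedBy v (avoid Z) hdetS0 hdetX2 (hmeas _) (hmeas _)
  rw [hST, hTsum, hi1, hi0]

/-- **Marginal of a block vertex**: `P_v(o ↔ a) = P_v(o ↔ c off Z) · P_v(c ↔ a on Z)` for `a ∈ Z`. [this work] -/
theorem real_openConn_in_eq (v : Sym2 (Fin n) → unitInterval) (ho : o ∉ Z) (hc : c ∉ Z)
    (hv : ∀ x y : Fin n, x ≠ y → x ∈ Z → y ∉ Z → y ≠ c → (v s(x, y) : ℝ) = 0) {a : Fin n} (ha : a ∈ Z) :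
    (prodBernoulli v).real (openConn o a) =
      (prodBernoulli v).real {ω | offZ Z ω ∈ openConn o c} * (prodBernoulli v).real {ω | onZ Z ω ∈ openConn c a} := by
  have hmeas : ∀ U : Set (BondConfig (Fin n)), MeasurableSet U := fun U => (Set.toFinite U).measurableSet
  have h1 : (prodBernoulli v).real (openConn o a) =
      (prodBernoulli v).real ({ω | offZ Z ω ∈ openConn o c} ∩ {ω | onZ Z ω ∈ openConn c a}) := by
    refine real_congr_of_good (c := c) (Z := Z) v hv _ _ fun ω hω => ?_
    simp only [Set.mem_inter_iff, mem_setOf_eq]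
    exact reach_in_iff hω ho hc ha
  rw [h1]
  exact prodBernoulli_real_inter_of_determinedBy v (avoid Z) (determinedBy_offZ Z fun η => η ∈ openConn o c)
    (determinedBy_onZ Z fun η => η ∈ openConn c a) (hmeas _) (hmeas _)

/-- **Marginal of a vertex off the block**: `P_v(o ↔ b) = P_v(o ↔ b off Z)` for `b ∉ Z`. [this work] -/
theorem real_openConn_off_eq (v : Sym2 (Fin n) → unitInterval) (ho : o ∉ Z)
    (hv : ∀ x y : Fin n, x ≠ y → x ∈ Z → y ∉ Z → y ≠ c → (v s(x, y) : ℝ) = 0) {b : Fin n} (hb : b ∉ Z) :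
    (prodBernoulli v).real (openConn o b) = (prodBernoulli v).real {ω | offZ Z ω ∈ openConn o b} :=
  real_congr_of_good (c := c) (Z := Z) v hv _ _ fun _ hω => reach_off_iff hω ho hb

/-- **The coefficients carry at least the mass of `J`**: `P(N_rest ≥ 2) + P(N_rest = 1, J) + P(N_rest = 0, J) ≥ P(J)` (any measure, any
count read off `offZ`). [this work] -/
theorem real_inter_J_le (μ : Measure (BondConfig (Fin n))) [IsFiniteMeasure μ] (B : Finset (Fin n)) :
    μ.real {ω : BondConfig (Fin n) | offZ Z ω ∈ openConn o c} ≤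
      μ.real {ω | 2 ≤ (B.filter fun a => offZ Z ω ∈ openConn o a).card} +
      μ.real {ω | (B.filter fun a => offZ Z ω ∈ openConn o a).card = 1 ∧ offZ Z ω ∈ openConn o c} +
      μ.real {ω | (B.filter fun a => offZ Z ω ∈ openConn o a).card = 0 ∧ offZ Z ω ∈ openConn o c} := by
  set S2 := {ω : BondConfig (Fin n) | 2 ≤ (B.filter fun a => offZ Z ω ∈ openConn o a).card} with hS2
  set S1 := {ω : BondConfig (Fin n) | (B.filter fun a => offZ Z ω ∈ openConn o a).card = 1 ∧ offZ Z ω ∈ openConn o c} with hS1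
  set S0 := {ω : BondConfig (Fin n) | (B.filter fun a => offZ Z ω ∈ openConn o a).card = 0 ∧ offZ Z ω ∈ openConn o c} with hS0
  have hsub : {ω : BondConfig (Fin n) | offZ Z ω ∈ openConn o c} ⊆ S2 ∪ S1 ∪ S0 := by
    intro ω hω
    simp only [hS2, hS1, hS0, Set.mem_union, mem_setOf_eq] at hω ⊢
    by_cases h2 : 2 ≤ (B.filter fun a => offZ Z ω ∈ openConn o a).card
    · exact Or.inl (Or.inl h2)
    · by_cases h1 : (B.filter fun a => offZ Z ω ∈ openConn o a).card = 1
      · exact Or.inl (Or.inr ⟨h1, hω⟩)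
      · exact Or.inr ⟨by omega, hω⟩
  calc μ.real {ω : BondConfig (Fin n) | offZ Z ω ∈ openConn o c}
      ≤ μ.real (S2 ∪ S1 ∪ S0) := measureReal_mono hsub
    _ ≤ μ.real (S2 ∪ S1) + μ.real S0 := measureReal_union_le _ _
    _ ≤ μ.real S2 + μ.real S1 + μ.real S0 := by linarith [measureReal_union_le (μ := μ) S2 S1]

end Law

end Block

end Quant

end Summit.CriticalPhenomena.PercolationContinuityZ3.Theorems
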